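import Summits.AtomisticToContinuum.BoseEinsteinCondensation.Theorems.BECConjugateDominationIMUChainGlueCornerSums
import Mathlib.MeasureTheory.Integral.Prod
import HarnessLib

/-!
# Route `BECConjugateDomination`, glue `IMUChainGlue` (stmt-AtomisticToContinuum-11790) —
# helper: the positive-definite test kernel

The autocorrelation `φ₀(s) = ∫_{ℝ³} η_a(x+s) η_a(x) dx` of the scaled bump (`φ₀ ≥ 0`, continuous,
`supp φ₀ ⊆ B(0,4a)`) has plane-wave integrals `∫ conj(eₙ) φ₀ = |Eₙ|² ≥ 0`, `Eₙ = ∫ conj(eₙ) η_a`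
(Fubini and the translation invariance of Lebesgue measure).  Its corner sum
`φ(r) = ∑_{ε ∈ {0,1}³} φ₀(r − Lε)` is therefore a continuous probability density on the cell
(`∫_{[0,L)³} φ = 1`) supported within `4a` of the corners, with cell Fourier coefficients
`ĉₙ(φ) = L⁻³ |Eₙ|²` — the positive-definite kernel against which `log g` is tested in the proof of
`IMUChainGlue`.
-/

noncomputable section

open MeasureTheory Set Complex
open scoped ENNReal NNReal Topology ComplexConjugate

namespace Summit.AtomisticToContinuum.BoseEinsteinCondensation.Theorems.IMUChainGlue

open Literature.MathematicalPhysics.QuantumManyBody.BoseGas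

/-- The eight corners `{0,1}³ ⊂ ℤ³` (local notation, as in the `Corners` file). -/
local notation "corners" => (Fintype.piFinset fun _ : Fin 3 => ({0, 1} : Finset ℤ))

/-- The fixed profile (local notation, as in the `Bump` file). -/
local notation "χ" => (ContDiffBump.normed
  (ContDiffBump.mk 1 2 one_pos one_lt_two : ContDiffBump (0 : Space)) volume)

/-- The scaled bump, value form (local notation, as in the `Bump` file). -/
local notation "ηv⟦" a ", " x "⟧" => (a ^ 3)⁻¹ * χ (a⁻¹ • x)

/-- The scaled bump, function form (local notation, as in the `Bump` file). -/
local notation "ηf⟦" a "⟧" => fun x : Space => (a ^ 3)⁻¹ * χ (a⁻¹ • x)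

/-- The autocorrelation of the scaled bump, value form:
`φ₀v⟦a, s⟧ = ∫ η_a(x + s) η_a(x) dx` (local notation). -/
local notation "φ₀v⟦" a ", " s "⟧" => ∫ x : Space, ηv⟦a, x + s⟧ * ηv⟦a, x⟧

/-! ### The autocorrelation of the bump -/

section Autocorrelation

variable {a : ℝ}

/-- The integrand of the autocorrelation vanishes unless `‖x‖ < 2a` and `‖s‖ < 4a`. -/
theorem bump_shift_mul_bump_eq_zero (ha : 0 < a) {s x : Space} (h : 4 * a ≤ ‖s‖ ∨ 2 * a ≤ ‖x‖) :
    ηv⟦a, x + s⟧ * ηv⟦a, x⟧ = 0 := by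
  by_cases hx : 2 * a ≤ ‖x‖
  · rw [bump_eq_zero ha hx, mul_zero]
  · have hs : 4 * a ≤ ‖s‖ := h.resolve_right hx
    have hxs : 2 * a ≤ ‖x + s‖ := by
      have h1 : ‖s‖ ≤ ‖x + s‖ + ‖x‖ := by
        calc ‖s‖ = ‖(x + s) - x‖ := by rw [add_sub_cancel_left]
          _ ≤ ‖x + s‖ + ‖x‖ := norm_sub_le _ _
      linarith [not_le.1 hx]
    rw [bump_eq_zero ha hxs, zero_mul]

/-- `φ₀ ≥ 0`. -/
theorem autocorr_nonneg (ha : 0 < a) (s : Space) : 0 ≤ φ₀v⟦a, s⟧ :=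
  integral_nonneg fun _ => mul_nonneg (bump_nonneg ha _) (bump_nonneg ha _)

/-- `φ₀(s) = 0` for `‖s‖ ≥ 4a`. -/
theorem autocorr_eq_zero (ha : 0 < a) {s : Space} (hs : 4 * a ≤ ‖s‖) : φ₀v⟦a, s⟧ = 0 := by
  simp only [bump_shift_mul_bump_eq_zero ha (Or.inl hs), integral_zero]

/-- The autocorrelation as an integral over a fixed compact ball. -/
theorem autocorr_eq_setIntegral (ha : 0 < a) (s : Space) :
    φ₀v⟦a, s⟧ = ∫ x in Metric.closedBall (0 : Space) (2 * a), ηv⟦a, x + s⟧ * ηv⟦a, x⟧ := by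
  refine (setIntegral_eq_integral_of_forall_compl_eq_zero fun x hx => ?_).symm
  refine bump_shift_mul_bump_eq_zero ha (Or.inr ?_)
  rw [Metric.mem_closedBall, dist_zero_right, not_le] at hx
  exact hx.le

/-- The integrand `(s, x) ↦ η_a(x+s) η_a(x)` is jointly continuous. -/
theorem continuous_bump_shift_mul_bump (a : ℝ) :
    Continuous fun p : Space × Space => ηv⟦a, p.2 + p.1⟧ * ηv⟦a, p.2⟧ :=
  ((continuous_bump a).comp (continuous_snd.add continuous_fst)).mul
    ((continuous_bump a).comp continuous_snd)

/-- `φ₀` is continuous. -/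
theorem continuous_autocorr (ha : 0 < a) : Continuous fun s : Space => φ₀v⟦a, s⟧ := by
  simp only [autocorr_eq_setIntegral ha]
  exact continuous_parametric_integral_of_continuous
    (f := fun (s x : Space) => ηv⟦a, x + s⟧ * ηv⟦a, x⟧) (continuous_bump_shift_mul_bump a)
    (isCompact_closedBall _ _)

/-- **The plane-wave integrals of the autocorrelation are squares**:
`∫ conj(eₙ) φ₀ = |Eₙ|²`, `Eₙ = ∫ conj(eₙ) η_a` (Fubini, `e_n(x+s) = e_n(x) e_n(s)`, translation
invariance of Lebesgue measure). -/
theorem integral_conj_cellWave_mul_autocorr (ha : 0 < a) (L : ℝ) (n : Fin 3 → ℤ) :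
    ∫ s, conj (cellWave L n s) * ((φ₀v⟦a, s⟧ : ℝ) : ℂ) =
      ((‖∫ x, conj (cellWave L n x) * ((ηv⟦a, x⟧ : ℝ) : ℂ)‖ ^ 2 : ℝ) : ℂ) := by
  set E : ℂ := ∫ x, conj (cellWave L n x) * ((ηv⟦a, x⟧ : ℝ) : ℂ) with hE
  -- the integrand of the double integral
  set G : Space → Space → ℂ := fun s x => conj (cellWave L n s) * ((ηv⟦a, x + s⟧ * ηv⟦a, x⟧ : ℝ) : ℂ)
    with hG
  have hGc : Continuous (Function.uncurry G) :=
    ((continuous_cellWave L n).star.comp continuous_fst).mul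
      (continuous_ofReal.comp (continuous_bump_shift_mul_bump a))
  have hGs : HasCompactSupport (Function.uncurry G) := by
    refine HasCompactSupport.intro ((isCompact_closedBall (0 : Space) (4 * a)).prod
      (isCompact_closedBall (0 : Space) (2 * a))) ?_
    rintro ⟨s, x⟩ hp
    rw [Set.mem_prod, Metric.mem_closedBall, Metric.mem_closedBall, dist_zero_right,
      dist_zero_right, not_and_or, not_le, not_le] at hp
    have h0 := bump_shift_mul_bump_eq_zero ha (s := s) (x := x) (hp.imp le_of_lt le_of_lt)
    show G s x = 0
    simp only [hG]
    rw [h0, Complex.ofReal_zero, mul_zero]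
  have hGi : Integrable (Function.uncurry G) ((volume : Measure Space).prod volume) :=
    hGc.integrable_of_hasCompactSupport hGs
  -- Step 1: pull the plane wave into the inner integral and swap
  have h1 : ∫ s, conj (cellWave L n s) * ((φ₀v⟦a, s⟧ : ℝ) : ℂ) = ∫ s, ∫ x, G s x := by
    refine integral_congr_ae (Filter.Eventually.of_forall fun s => ?_)
    simp only [hG]
    rw [integral_const_mul, integral_complex_ofReal]
  rw [h1, integral_integral_swap hGi]
  -- Step 2: the inner `s`-integral at fixed `x`
  have h2 : ∀ x : Space, ∫ s, G s x = ((ηv⟦a, x⟧ : ℝ) : ℂ) * cellWave L n x * E := by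
    intro x
    have hu : cellWave L n x * conj (cellWave L n x) = 1 := by
      rw [Complex.mul_conj, Complex.normSq_eq_norm_sq, norm_cellWave]; simp
    have hpt : ∀ s : Space, G s x = ((ηv⟦a, x⟧ : ℝ) : ℂ) * cellWave L n x *
        (conj (cellWave L n (x + s)) * ((ηv⟦a, x + s⟧ : ℝ) : ℂ)) := by
      intro s
      simp only [hG, cellWave_add, map_mul]
      linear_combination (norm := skip)
        (-(conj (cellWave L n s) * ((ηv⟦a, x + s⟧ : ℝ) : ℂ) * ((ηv⟦a, x⟧ : ℝ) : ℂ))) * hu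
      push_cast
      ring
    simp_rw [hpt]
    rw [integral_const_mul]
    congr 1
    exact integral_add_left_eq_self (fun t : Space => conj (cellWave L n t) * ((ηv⟦a, t⟧ : ℝ) : ℂ)) x
  simp_rw [h2]
  -- Step 3: the outer `x`-integral is the conjugate of `E`
  rw [integral_mul_const]
  have h3 : ∫ x, ((ηv⟦a, x⟧ : ℝ) : ℂ) * cellWave L n x = conj E := by
    rw [hE, ← integral_conj]
    refine integral_congr_ae (Filter.Eventually.of_forall fun x => ?_)
    simp only [map_mul, Complex.conj_conj, Complex.conj_ofReal, mul_comm]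
  rw [h3, mul_comm, Complex.mul_conj, Complex.normSq_eq_norm_sq]

/-- **`∫ φ₀ = 1`** (the case `n = 0`: `E₀ = ∫η_a = 1`). -/
theorem integral_autocorr (ha : 0 < a) : ∫ s : Space, φ₀v⟦a, s⟧ = 1 := by
  have h := integral_conj_cellWave_mul_autocorr ha 1 0
  simp only [cellWave_zero, map_one, one_mul, integral_complex_ofReal, integral_bump ha,
    Complex.ofReal_one, norm_one, one_pow] at h
  exact_mod_cast h

end Autocorrelation

/-! ### The kernel: the corner sum of the autocorrelation -/

section Kernel

variable {L a : ℝ}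

/-- The kernel `φ(r) = ∑_ε φ₀(r − Lε)` is continuous (real form). -/
theorem continuous_kernel (ha : 0 < a) (L : ℝ) :
    Continuous fun r : Space => ∑ ε ∈ corners, φ₀v⟦a, r - latticeVec L ε⟧ :=
  continuous_finsetSum _ fun _ _ => (continuous_autocorr ha).comp (continuous_sub_right _)

/-- The kernel is non-negative. -/
theorem kernel_nonneg (ha : 0 < a) (L : ℝ) (r : Space) :
    0 ≤ ∑ ε ∈ corners, φ₀v⟦a, r - latticeVec L ε⟧ :=
  Finset.sum_nonneg fun _ _ => autocorr_nonneg ha _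

/-- **Support of the kernel**: where `φ(r) ≠ 0`, the point `r` lies within `4a` of a corner `Lε`. -/
theorem exists_corner_of_kernel_ne_zero (ha : 0 < a) {r : Space}
    (hr : ∑ ε ∈ corners, φ₀v⟦a, r - latticeVec L ε⟧ ≠ 0) :
    ∃ ε ∈ corners, ‖r - latticeVec L ε‖ < 4 * a := by
  by_contra h
  refine hr (Finset.sum_eq_zero fun ε hε => autocorr_eq_zero ha ?_)
  by_contra h'
  exact h ⟨ε, hε, not_le.1 h'⟩

/-- **The cell Fourier coefficients of the kernel are `L⁻³ |Eₙ|² ≥ 0`** (`4a ≤ L`). -/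
theorem cellFourierCoeff_kernel (hL : 0 < L) (ha : 0 < a) (h4a : 4 * a ≤ L) (n : Fin 3 → ℤ) :
    cellFourierCoeff L (fun r : Space => ∑ ε ∈ corners, ((φ₀v⟦a, r - latticeVec L ε⟧ : ℝ) : ℂ)) n =
      ((((L ^ 3)⁻¹ * ‖∫ x, conj (cellWave L n x) * ((ηv⟦a, x⟧ : ℝ) : ℂ)‖ ^ 2 : ℝ)) : ℂ) := by
  rw [cellFourierCoeff_cornerSum (h := fun s => φ₀v⟦a, s⟧) hL h4a (continuous_autocorr ha)
    (fun s hs => autocorr_eq_zero ha hs) n, integral_conj_cellWave_mul_autocorr ha L n,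
    Complex.real_smul]
  push_cast
  ring

/-- **The kernel is a probability density on the cell**: `∫_{[0,L)³} φ = 1` (`4a ≤ L`). -/
theorem setIntegral_kernel (ha : 0 < a) (h4a : 4 * a ≤ L) :
    ∫ r in cell L, ∑ ε ∈ corners, φ₀v⟦a, r - latticeVec L ε⟧ = 1 := by
  have hcs : HasCompactSupport fun s : Space => φ₀v⟦a, s⟧ := by
    refine HasCompactSupport.of_support_subset_isCompact (isCompact_closedBall (0 : Space) (4 * a)) ?_
    intro s hs
    rw [Metric.mem_closedBall, dist_zero_right]
    by_contra hlt
    exact hs (autocorr_eq_zero ha (not_le.1 hlt).le)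
  rw [integral_finsetSum]
  · calc ∑ ε ∈ corners, ∫ r in cell L, φ₀v⟦a, r - latticeVec L ε⟧
        = ∫ s, φ₀v⟦a, s⟧ := sum_corners_setIntegral_cell_sub (f := fun s => φ₀v⟦a, s⟧) h4a
            (fun s hs => autocorr_eq_zero ha hs) ((continuous_autocorr ha).integrable_of_hasCompactSupport hcs)
      _ = 1 := integral_autocorr ha
  · intro ε _
    exact integrableOn_cell ((continuous_autocorr ha).comp (continuous_sub_right (latticeVec L ε)))

end Kernel

end Summit.AtomisticToContinuum.BoseEinsteinCondensation.Theorems.IMUChainGlue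

end
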